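import Summits.BirchSwinnertonDyer.BirchSwinnertonDyer.Theses.TameQuarticSolvent
import Summits.BirchSwinnertonDyer.BirchSwinnertonDyer.Theorems.TameQuarticSolventSolventPairLowerBoundPairGivenGoodFieldOfLower
import Summits.BirchSwinnertonDyer.BirchSwinnertonDyer.Theorems.TameQuarticSolventSolventPairLowerBoundKolyvaginTwistedUpperAnalyticHalf
import HarnessLib

set_option linter.dupNamespace false

noncomputable section

open scoped Classical NumberField

open WeierstrassCurve Literature.NumberTheory.EllipticCurves Literature.NumberTheory.EllipticCurves.ModularForms
  Literature.NumberTheory.EllipticCurves.Rank1Residual IsDedekindDomain NumberField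

/-! Skeleton OF RECORD v6 (line `birth`, crux `SolventPairLowerBound` = stmt-BirchSwinnertonDyer-21391, route
TameQuarticSolvent; v3 lead tqs-p1 g0, v4 width seat w3, v5/v6 lead tqs-p1 g3, 2026-08-27/28). The composition
`SolventPairLowerBound_of : StubTwistDatum → StubGoodReduction → StubPairGivenGoodField → crux` and the three
`def Stub…` abbreviations are UNCHANGED since v3; v4 → v5 replaced exact K1 by its LOWER half K1⁻ (w3, p582415);
v5 → v6 integrates the width wave's K2a results: the twisted constituent `E′ = (E_K)^{(β)}` is GOOD SUPERSINGULAR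
at the prime above `3` (`a_𝔭 = 0`, `#Ẽ′(𝔽₃) = 4`: w2 p584727, lead g3 p585142/p586232), and on the rows with an ODD
MULTIPLICATIVE prime `ℓ₀ ≠ 3` (3 462 / 3 533 census classes) the ANALYTIC half of K2a — an admissible `β` with
`L(E′/K, s)` entire and `L(E′/K, 1) ≠ 0` — follows from Friedberg–Hoffstein over `K` (w2 p584089, two named facts
p583309/p583482). So v6 cuts K2a (`stub_kolyvaginTwistedUpperOverK`, now DERIVED) into
* `stub_kolyvaginUpperRankZeroOverK` (K2a-ES₀: the EULER-SYSTEM half in analytic rank ZERO — for `W` on the leaf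
  with an odd multiplicative prime, every admissible `(d, K, β)` with `L((W_K)^{(β)}, 1) ≠ 0`: `Ш[3^∞]` finite,
  `#Ш_an ∈ ℚ`, `ord₃ #Ш[3^∞] ≤ ord₃ #Ш_an` for the twist — Kolyvagin–Logachëv / Longo / Nekovář / Yuan–Zhang–Zhang
  over the real quadratic `K` at a GOOD supersingular `𝔭 ∣ 3`; the sharp `3`-part is NOT in print), and
* `stub_kolyvaginTwistedUpperOverK_noOddMult` (K2a-rest: the v5 text verbatim on the ≤ 71 classes WITHOUT an odd
  multiplicative prime `ℓ₀ ≠ 3`, where the rank-zero road needs a sign flip at `2` or at an additive prime — or the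
  rank-one road),
keeps `stub_lowerBSD3OverSolventQuartic` (K1⁻, the real crux: the LOWER half of `BSD₃(E_M/M)` over the totally real
tame quartic, signed-IMC «⊇» at the good supersingular `w`, `e = 4 > p − 1` — OPEN mathematics), and widens
`stub_publishedInputs` to EIGHT named print facts (NOT a prover target; closes only via Literature `…_holds`).
Derived (no sorry of their own): `stub_goodReduction` (p571347), `stub_twistDatum` (p579407), `stub_pairGivenGoodField`
(p582415), `stub_kolyvaginTwistedUpperOverK` (this file, by cases on the odd multiplicative prime, from p584089 +
K2a-ES₀ / K2a-rest). Sorries only inside `stub_*`; `SolventPairLowerBound_holds_of_stubs` concludes the ROUTE DECL by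
name. BSD is not proved by any of this. -/

namespace Summit.BirchSwinnertonDyer.BirchSwinnertonDyer.Cruxes.SolventPairLowerBound.Birth

/-- Stub 1 (M): an ADMISSIBLE RANK-ZERO TWIST exists — d > 0, v₃(d) = 1 (so ℚ(√d) is real and ramified
at 3), a globally minimal model of E^(d), again non-CM and (t′) at 3, with r_an = 0. Friedberg–Hoffstein
1995 Thm B (prescribed local behaviour + nonvanishing) plus Tate's algorithm for the twist at 3 and the
root-number bookkeeping. -/
def StubTwistDatum : Prop :=
  ∀ (W : WeierstrassCurve ℚ) [W.IsElliptic] [W.IsGloballyMinimal],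
    ¬ W.HasCM → Addv W 3 → Summit.BirchSwinnertonDyer.Rank1Residual.Additive.SubTprime W 3 → W.analyticRank = 1 →
    ∃ (d : ℤ) (Wd : WeierstrassCurve ℚ) (_ : Wd.IsElliptic) (_ : Wd.IsGloballyMinimal),
      0 < d ∧ padicValInt 3 d = 1 ∧
      (∃ C : WeierstrassCurve.VariableChange ℚ, C • W.quadraticTwist (d : ℚ) = Wd) ∧
      ¬ Wd.HasCM ∧ Addv Wd 3 ∧ Summit.BirchSwinnertonDyer.Rank1Residual.Additive.SubTprime Wd 3 ∧ Wd.analyticRank = 0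

/-- Stub 2 (M, the LEVER / named first lemma): a curve additive of class (t′) at 3 (tame, e = 4,
potentially good) acquires GOOD reduction at every place w ∣ 3 of ramification index 4 of any number
field (Serre–Tate / Néron–Ogg–Shafarevich over the tame quartic; the reduction is supersingular with
a_w = 0). -/
def StubGoodReduction : Prop :=
  ∀ (W : WeierstrassCurve ℚ) [W.IsElliptic] [W.IsGloballyMinimal], Addv W 3 → Summit.BirchSwinnertonDyer.Rank1Residual.Additive.SubTprime W 3 →
    ∀ (L : Type) [Field L] [NumberField L] (v : HeightOneSpectrum (𝓞 L)),
      ((3 : ℕ) : 𝓞 L) ∈ v.asIdeal → v.asIdeal.ramificationIdx ℤ = 4 →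
      (W.baseChange L).HasGoodReductionAt v

/-- Stub 3 (XL, load-bearing): the PAIR INEQUALITY given the lever — for E on the leaf such that E has
good reduction at every index-4 place over 3 of every number field, and any admissible rank-zero twist
datum (d, E_d): ord₃ Ш_an(E) + ord₃ Ш_an(E_d) ≤ ord₃ #Ш(E) + ord₃ #Ш(E_d). Inside: exact BSD₃(E/L″) over
the totally real tame quartic L″ = ℚ(√d)(√β) (signed two-variable IMC over K·L″ at the good split
supersingular w, BDP value, Howard–Nekovář Kolyvagin system), Kolyvagin's upper bound for E_ℚ(√d) ⊗ χ_β,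
and restriction-of-scalars / Artin bookkeeping (Milne 1972). -/
def StubPairGivenGoodField : Prop :=
  ∀ (W : WeierstrassCurve ℚ) [W.IsElliptic] [W.IsGloballyMinimal],
    ¬ W.HasCM → Addv W 3 → Summit.BirchSwinnertonDyer.Rank1Residual.Additive.SubTprime W 3 → W.analyticRank = 1 →
    (∀ (L : Type) [Field L] [NumberField L] (v : HeightOneSpectrum (𝓞 L)),
      ((3 : ℕ) : 𝓞 L) ∈ v.asIdeal → v.asIdeal.ramificationIdx ℤ = 4 →
      (W.baseChange L).HasGoodReductionAt v) →
    ∀ (d : ℤ) (Wd : WeierstrassCurve ℚ) [Wd.IsElliptic] [Wd.IsGloballyMinimal],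
      0 < d → padicValInt 3 d = 1 →
      (∃ C : WeierstrassCurve.VariableChange ℚ, C • W.quadraticTwist (d : ℚ) = Wd) →
      ¬ Wd.HasCM → Addv Wd 3 → Summit.BirchSwinnertonDyer.Rank1Residual.Additive.SubTprime Wd 3 → Wd.analyticRank = 0 →
      ∃ q q' : ℚ, shaAn W = (q : ℂ) ∧ shaAn Wd = (q' : ℂ) ∧
        padicValRat 3 q + padicValRat 3 q' ≤
          (padicValNat 3 W.shaOrder : ℤ) + (padicValNat 3 Wd.shaOrder : ℤ)

/-! ### The live stubs (v6: PUB · K1⁻ · K2a-ES₀ · K2a-rest) -/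

/-- Stub PUB (published inputs BY NAME — NOT a prover target; closes only via Literature `…_holds` discharges):
modularity in the two shapes the tree uses (Breuil–Conrad–Diamond–Taylor: `exists_isNewformOf`,
`nonempty_modularParametrizationData`), Gross–Zagier 1986 Thm. I.(7.3), Gross–Zagier–Kolyvagin
(`rank = r_an`, `Ш` finite for `r_an ≤ 1`), Dokchitser–Dokchitser 2010 Thm. 2.3 `p`-part in Milne's
restriction-of-scalars form, Friedberg–Hoffstein 1995 Thm. B(1) over `ℚ` with ramification prescribed at `3`, and
(v6) Friedberg–Hoffstein Thm. B(1) over the real quadratic `K` in the «flip» / «no-flip» classes (p583309/p583482). -/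
theorem stub_publishedInputs :
    exists_isNewformOf ∧ nonempty_modularParametrizationData ∧ GrossZagier1986_thm_I_7_3 ∧
      rank_eq_analyticRank_of_analyticRank_le_one ∧
      Milne1972.bsdQuotientP_baseChange_relQuadratic_anyModel ∧
      friedbergHoffstein_exists_pos_twist_ne_zero_ramifiedAtThree ∧
      friedbergHoffstein_exists_twist_ne_zero_realQuadratic_tameAtThree ∧
      friedbergHoffstein_exists_twist_ne_zero_realQuadratic_tameAtThree_noflip := by
  sorry

/-- Stub K1⁻ (XL, the real crux — «LowerBSD3OverSolventQuartic»): for `E/ℚ` on the leaf and every totally real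
quartic `M ⊃ K` (`[K:ℚ] = [M:K] = 2`) with ramification index `4` and good reduction for `E_M` at every place above
`3`: IF `Ш(E_M/M)[3^∞]` is finite THEN every rational value `qM` of `#Ш_an(E_M/M)` satisfies
`ord₃ qM ≤ ord₃ #Ш(E_M/M)[3^∞]` — the LOWER half of the `3`-part of the Birch–Swinnerton-Dyer formula for `E` over
`M` only (the «main-conjecture ⊇» / Eisenstein direction of signed Iwasawa theory over the ramified quartic base,
`e = 4 > p − 1`, at the good supersingular `w` with `a_w = 0`); implied by BSD for `E/M`; strictly weaker than v4's
exact K1 (`lowerBound_of_bsdpOver`). -/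
theorem stub_lowerBSD3OverSolventQuartic :
    ∀ (W : WeierstrassCurve ℚ) [W.IsElliptic] [W.IsGloballyMinimal],
      ¬ W.HasCM → Addv W 3 → Summit.BirchSwinnertonDyer.Rank1Residual.Additive.SubTprime W 3 →
      W.analyticRank = 1 →
      ∀ (K : Type) [Field K] [NumberField K] (M : Type) [Field M] [NumberField M] [Algebra K M],
        Module.finrank ℚ K = 2 → Module.finrank K M = 2 → IsTotallyReal M →
        (∀ w : HeightOneSpectrum (𝓞 M), ((3 : ℕ) : 𝓞 M) ∈ w.asIdeal →
          w.asIdeal.ramificationIdx ℤ = 4) →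
        (∀ w : HeightOneSpectrum (𝓞 M), ((3 : ℕ) : 𝓞 M) ∈ w.asIdeal →
          (W.baseChange M).HasGoodReductionAt w) →
        Finite (AddCommGroup.primaryComponent (W.baseChange M).sha 3) →
        ∀ qM : ℚ, analyticSha (W.baseChange M) = (qM : ℂ) →
          padicValRat 3 qM ≤
            padicValNat 3 (Nat.card (AddCommGroup.primaryComponent (W.baseChange M).sha 3)) := by
  sorry

/-- Stub K2a-ES₀ (L–XL — «KolyvaginUpperRankZeroOverK», v6): the EULER-SYSTEM HALF of K2a in analytic rank ZERO.
For `W` on the leaf having an ODD prime `ℓ₀ ≠ 3` of multiplicative reduction, every `d > 0` with `ord₃ d = 1`,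
every quadratic `K ∋ θ₁` (`θ₁² = d`), and every `β ∈ K` of odd valuation above `3`, totally positive, such that the
twist `E′ = (W_K)^{(β)}` (GOOD supersingular at `𝔭 ∣ 3`, `a_𝔭 = 0`: p584727/p586232) has an entire `L`-function with
`L(E′/K, 1) ≠ 0`: `Ш(E′/K)[3^∞]` is finite, `#Ш_an(E′/K) ∈ ℚ`, and `ord₃ #Ш(E′/K)[3^∞] ≤ ord₃ #Ш_an(E′/K)`
(Kolyvagin–Logachëv / Longo 2006 / Nekovář 2007 Euler system of CM points on the Shimura curve attached to `E′/K` —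
Jacquet–Langlands hypothesis for `[K:ℚ] = 2` met at the multiplicative place over `ℓ₀` — with Zhang / Yuan–Zhang–Zhang
Gross–Zagier; the SHARP `3`-part (no Tamagawa / index slack, `E′[3]` possibly reducible) is NOT in print). -/
theorem stub_kolyvaginUpperRankZeroOverK :
    ∀ (W : WeierstrassCurve ℚ) [W.IsElliptic] [W.IsGloballyMinimal],
      ¬ W.HasCM → Addv W 3 → Summit.BirchSwinnertonDyer.Rank1Residual.Additive.SubTprime W 3 →
      W.analyticRank = 1 →
      (∃ (ℓ₀ : ℕ) (_ : Fact ℓ₀.Prime), ℓ₀ ≠ 2 ∧ ℓ₀ ≠ 3 ∧ W.HasMultiplicativeReductionAtPrime ℓ₀) →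
      ∀ (d : ℤ), 0 < d → padicValInt 3 d = 1 →
      ∀ (K : Type) [Field K] [NumberField K] (θ₁ : K), Module.finrank ℚ K = 2 → θ₁ ^ 2 = (d : K) →
      ∀ β : K,
        (∀ v : HeightOneSpectrum (𝓞 K), ((3 : ℕ) : 𝓞 K) ∈ v.asIdeal →
          ∃ k : ℤ, v.valuation K β = WithZero.exp (2 * k + 1)) →
        (∀ σ : K →+* ℝ, 0 < σ β) →
        ((W.baseChange K).quadraticTwist β).HasEntireLFunction →
        ((W.baseChange K).quadraticTwist β).entireLFunction 1 ≠ 0 →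
        Finite (AddCommGroup.primaryComponent ((W.baseChange K).quadraticTwist β).sha 3) ∧
          ∃ qβ : ℚ, analyticSha ((W.baseChange K).quadraticTwist β) = (qβ : ℂ) ∧
            (padicValNat 3
                (Nat.card (AddCommGroup.primaryComponent ((W.baseChange K).quadraticTwist β).sha 3)) : ℤ) ≤
              padicValRat 3 qβ := by
  sorry

/-- Stub K2a-rest (L–XL — «KolyvaginTwistedUpperOverK» on the rows WITHOUT an odd multiplicative prime, v6): the v5
text of K2a verbatim, restricted to `W` having NO odd prime `ℓ₀ ≠ 3` of multiplicative reduction (≤ 71 census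
classes: 19 with all bad primes additive, the rest with `2` the only multiplicative prime). Here the rank-zero road
needs a sign flip at a place over `2` or at an additive `ℓ` (local-type case analysis, census ask PARITY-K2A-w2 §4),
else the rank-ONE road over `K` (Gross–Zagier–Zhang + Kolyvagin); the statement stays rank-agnostic. -/
theorem stub_kolyvaginTwistedUpperOverK_noOddMult :
    ∀ (W : WeierstrassCurve ℚ) [W.IsElliptic] [W.IsGloballyMinimal],
      ¬ W.HasCM → Addv W 3 → Summit.BirchSwinnertonDyer.Rank1Residual.Additive.SubTprime W 3 →
      W.analyticRank = 1 →
      ¬ (∃ (ℓ₀ : ℕ) (_ : Fact ℓ₀.Prime), ℓ₀ ≠ 2 ∧ ℓ₀ ≠ 3 ∧ W.HasMultiplicativeReductionAtPrime ℓ₀) →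
      ∀ (d : ℤ), 0 < d → padicValInt 3 d = 1 →
      ∀ (K : Type) [Field K] [NumberField K] (θ₁ : K), Module.finrank ℚ K = 2 → θ₁ ^ 2 = (d : K) →
        ∃ β : K,
          (∀ v : HeightOneSpectrum (𝓞 K), ((3 : ℕ) : 𝓞 K) ∈ v.asIdeal →
            ∃ k : ℤ, v.valuation K β = WithZero.exp (2 * k + 1)) ∧
          (∀ σ : K →+* ℝ, 0 < σ β) ∧
          ∃ (Vβ : WeierstrassCurve K) (_ : Vβ.IsElliptic),
            (∃ C : WeierstrassCurve.VariableChange K, C • (W.baseChange K).quadraticTwist β = Vβ) ∧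
            Vβ.HasEntireLFunction ∧
            Finite (AddCommGroup.primaryComponent Vβ.sha 3) ∧
            ∃ qβ : ℚ, analyticSha Vβ = (qβ : ℂ) ∧
              (padicValNat 3 (Nat.card (AddCommGroup.primaryComponent Vβ.sha 3)) : ℤ) ≤
                padicValRat 3 qβ := by
  sorry

/-- K2a («KolyvaginTwistedUpperOverK», the v4/v5 stub) — DERIVED in v6: on the rows with an odd multiplicative prime
from the analytic half (w2's `exists_totallyPositive_oddAtThree_twist_L_ne_zero_of_friedbergHoffstein`, p584089, fed by
the two Friedberg–Hoffstein-over-`K` named facts of `stub_publishedInputs`) and K2a-ES₀, with `Vβ` the twist itself;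
on the other rows it is K2a-rest. -/
theorem stub_kolyvaginTwistedUpperOverK :
    ∀ (W : WeierstrassCurve ℚ) [W.IsElliptic] [W.IsGloballyMinimal],
      ¬ W.HasCM → Addv W 3 → Summit.BirchSwinnertonDyer.Rank1Residual.Additive.SubTprime W 3 →
      W.analyticRank = 1 →
      ∀ (d : ℤ), 0 < d → padicValInt 3 d = 1 →
      ∀ (K : Type) [Field K] [NumberField K] (θ₁ : K), Module.finrank ℚ K = 2 → θ₁ ^ 2 = (d : K) →
        ∃ β : K,
          (∀ v : HeightOneSpectrum (𝓞 K), ((3 : ℕ) : 𝓞 K) ∈ v.asIdeal →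
            ∃ k : ℤ, v.valuation K β = WithZero.exp (2 * k + 1)) ∧
          (∀ σ : K →+* ℝ, 0 < σ β) ∧
          ∃ (Vβ : WeierstrassCurve K) (_ : Vβ.IsElliptic),
            (∃ C : WeierstrassCurve.VariableChange K, C • (W.baseChange K).quadraticTwist β = Vβ) ∧
            Vβ.HasEntireLFunction ∧
            Finite (AddCommGroup.primaryComponent Vβ.sha 3) ∧
            ∃ qβ : ℚ, analyticSha Vβ = (qβ : ℂ) ∧
              (padicValNat 3 (Nat.card (AddCommGroup.primaryComponent Vβ.sha 3)) : ℤ) ≤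
                padicValRat 3 qβ := by
  intro W _ _ hCM hadd hsub hr d hd0 hd K _ _ θ₁ h2 hθ₁
  by_cases hmult : ∃ (ℓ₀ : ℕ) (_ : Fact ℓ₀.Prime), ℓ₀ ≠ 2 ∧ ℓ₀ ≠ 3 ∧ W.HasMultiplicativeReductionAtPrime ℓ₀
  · obtain ⟨β, hval, hpos, hL, hL1⟩ :=
      Summit.BirchSwinnertonDyer.BirchSwinnertonDyer.Theorems.SolventPairLowerBound.exists_totallyPositive_oddAtThree_twist_L_ne_zero_of_friedbergHoffstein
        stub_publishedInputs.1 stub_publishedInputs.2.2.2.2.2.2.1 stub_publishedInputs.2.2.2.2.2.2.2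
        W hCM hadd hsub hr hmult d hd0 hd K θ₁ h2 hθ₁
    obtain ⟨hfin, qβ, hqβ, hle⟩ :=
      stub_kolyvaginUpperRankZeroOverK W hCM hadd hsub hr hmult d hd0 hd K θ₁ h2 hθ₁ β hval hpos hL hL1
    have hd' : (d : K) ≠ 0 := by exact_mod_cast hd0.ne'
    have hβ0 : β ≠ 0 := by
      intro h0
      obtain ⟨v, hv⟩ :=
        Summit.BirchSwinnertonDyer.BirchSwinnertonDyer.Theorems.SolventPairLowerBound.exists_heightOneSpectrum_natCast_mem K 3
      obtain ⟨k, hk⟩ := hval v hv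
      rw [h0, map_zero] at hk
      exact WithZero.exp_ne_zero hk.symm
    haveI : (W.baseChange K).IsElliptic := by rw [WeierstrassCurve.baseChange]; infer_instance
    haveI : NeZero (2 : K) := ⟨two_ne_zero⟩
    exact ⟨β, hval, hpos, (W.baseChange K).quadraticTwist β, isElliptic_quadraticTwist _ hβ0,
      ⟨1, one_smul _ _⟩, hL, hfin, qβ, hqβ, hle⟩
  · exact stub_kolyvaginTwistedUpperOverK_noOddMult W hCM hadd hsub hr hmult d hd0 hd K θ₁ h2 hθ₁

/-! ### The three v3 stubs, now derived -/

theorem stub_twistDatum :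
    ∀ (W : WeierstrassCurve ℚ) [W.IsElliptic] [W.IsGloballyMinimal],
    ¬ W.HasCM → Addv W 3 → Summit.BirchSwinnertonDyer.Rank1Residual.Additive.SubTprime W 3 → W.analyticRank = 1 →
    ∃ (d : ℤ) (Wd : WeierstrassCurve ℚ) (_ : Wd.IsElliptic) (_ : Wd.IsGloballyMinimal),
      0 < d ∧ padicValInt 3 d = 1 ∧
      (∃ C : WeierstrassCurve.VariableChange ℚ, C • W.quadraticTwist (d : ℚ) = Wd) ∧
      ¬ Wd.HasCM ∧ Addv Wd 3 ∧ Summit.BirchSwinnertonDyer.Rank1Residual.Additive.SubTprime Wd 3 ∧ Wd.analyticRank = 0 :=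
  -- DERIVED: Theorems/…TwistDatumOfFriedbergHoffstein.lean (p579407) from modularity + Friedberg–Hoffstein at 3
  Summit.BirchSwinnertonDyer.BirchSwinnertonDyer.Theorems.SolventPairLowerBound.stub_twistDatum_of_friedbergHoffstein
    stub_publishedInputs.1 stub_publishedInputs.2.2.2.2.2.1

theorem stub_goodReduction :
    ∀ (W : WeierstrassCurve ℚ) [W.IsElliptic] [W.IsGloballyMinimal], Addv W 3 →
      Summit.BirchSwinnertonDyer.Rank1Residual.Additive.SubTprime W 3 →
    ∀ (L : Type) [Field L] [NumberField L] (v : HeightOneSpectrum (𝓞 L)),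
      ((3 : ℕ) : 𝓞 L) ∈ v.asIdeal → v.asIdeal.ramificationIdx ℤ = 4 →
      (W.baseChange L).HasGoodReductionAt v :=
  -- PROVED: Theorems/TameQuarticSolventSolventPairLowerBoundStubGoodReduction.lean (p571347)
  Summit.BirchSwinnertonDyer.BirchSwinnertonDyer.Theorems.SolventPairLowerBound.stub_goodReduction

theorem stub_pairGivenGoodField :
    ∀ (W : WeierstrassCurve ℚ) [W.IsElliptic] [W.IsGloballyMinimal],
    ¬ W.HasCM → Addv W 3 → Summit.BirchSwinnertonDyer.Rank1Residual.Additive.SubTprime W 3 → W.analyticRank = 1 →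
    (∀ (L : Type) [Field L] [NumberField L] (v : HeightOneSpectrum (𝓞 L)),
      ((3 : ℕ) : 𝓞 L) ∈ v.asIdeal → v.asIdeal.ramificationIdx ℤ = 4 →
      (W.baseChange L).HasGoodReductionAt v) →
    ∀ (d : ℤ) (Wd : WeierstrassCurve ℚ) [Wd.IsElliptic] [Wd.IsGloballyMinimal],
      0 < d → padicValInt 3 d = 1 →
      (∃ C : WeierstrassCurve.VariableChange ℚ, C • W.quadraticTwist (d : ℚ) = Wd) →
      ¬ Wd.HasCM → Addv Wd 3 → Summit.BirchSwinnertonDyer.Rank1Residual.Additive.SubTprime Wd 3 → Wd.analyticRank = 0 →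
      ∃ q q' : ℚ, shaAn W = (q : ℂ) ∧ shaAn Wd = (q' : ℂ) ∧
        padicValRat 3 q + padicValRat 3 q' ≤
          (padicValNat 3 W.shaOrder : ℤ) + (padicValNat 3 Wd.shaOrder : ℤ) :=
  -- DERIVED: Theorems/…PairGivenGoodFieldOfLower.lean (p582415) from published inputs + K1⁻ + K2a
  Summit.BirchSwinnertonDyer.BirchSwinnertonDyer.Theorems.SolventPairLowerBound.stub_pairGivenGoodField_of_lower
    stub_publishedInputs.2.2.2.2.1 stub_publishedInputs.1 stub_publishedInputs.2.1 stub_publishedInputs.2.2.1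
    stub_publishedInputs.2.2.2.1 stub_lowerBSD3OverSolventQuartic stub_kolyvaginTwistedUpperOverK

/-- The kernel-checked composition: the three stubs give the route crux BY NAME. -/
theorem SolventPairLowerBound_of :
    StubTwistDatum → StubGoodReduction → StubPairGivenGoodField →
      Summit.BirchSwinnertonDyer.BirchSwinnertonDyer.Theses.TameQuarticSolvent.SolventPairLowerBound := by
  intro h1 h2 h3 W _ _ hCM hadd hsub hr
  obtain ⟨d, Wd, i1, i2, hd, hv, htw, hCMd, haddd, hsubd, hr0⟩ := h1 W hCM hadd hsub hr
  exact ⟨d, Wd, i1, i2, hd, hv, htw, hCMd, haddd, hsubd, hr0,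
    h3 W hCM hadd hsub hr (h2 W hadd hsub) d Wd hd hv htw hCMd haddd hsubd hr0⟩

/-- The crux from the registered stubs. -/
theorem SolventPairLowerBound_holds_of_stubs :
    Summit.BirchSwinnertonDyer.BirchSwinnertonDyer.Theses.TameQuarticSolvent.SolventPairLowerBound :=
  SolventPairLowerBound_of stub_twistDatum stub_goodReduction stub_pairGivenGoodField

end Summit.BirchSwinnertonDyer.BirchSwinnertonDyer.Cruxes.SolventPairLowerBound.Birth

end
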